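import Summits.CriticalPhenomena.PercolationContinuityZ3.Theorems.PercNearOneGluingNoHeavyLowerTailQuantitativeBHKForcedOpening
import Summits.CriticalPhenomena.PercolationContinuityZ3.Theorems.PercNearOneGluingNoHeavyLowerTailCovTauBridge
import Literature.Probability.LatticeModels.ProdBernoulliIndependence
import Literature.Probability.Percolation.KozmaNitzanClusterProperty
import HarnessLib

/-!
# Quantitative BHK Thm 1.3: the Glauber floor `Cov_ν(F,G) ≥ E_ν[Cov_ν(F,G | ω off e)]` under `ν = μ(· | s ↮ X)`

Support file (`--supports stmt-CriticalPhenomena-4575`), prover seat `prim-rate-mine-2` (lane prim-rate, constants-miner (c), BENCH rows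
M2-R8(a)/(b); `run/shared/lean/prim/prim-rate/prim-rate-mine-2/CANDIDATES.md` §gen-2, PROOFS.md §P11–P12).  Two auxiliary definitions
(`QuantBHK.rCHat`, the forced-opened cluster, and `QuantBHK.blockEHat`), no named facts, no sorries; standard axioms.

van den Berg–Häggström–Kahn (2006) prove that the open edge cluster `C_s` is positively associated given `D = {s ↮ X}` (Thm 1.3; tree
`BHK2006_clusterConditionalPositiveAssociation_holds`, via the functional Thm 1.1 = `BHK2006.core`).  This file makes the inequality
QUANTITATIVE, with the one-pair Glauber (heat-bath) term as the floor: for increasing `F, G`, any avoided set `X` and ANY pair `e`,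

  `μ(D)·w_e(1−w_e)·∫ 1_D(ω∪e)·(F(C_s(ω∪e)) − F(C_s(ω∖e)))·(G(C_s(ω∪e)) − G(C_s(ω∖e))) dμ ≤ μ(D)·∫_D F G − (∫_D F)(∫_D G)`

(`QuantBHK.condCov_ge_glauberTerm`; averaged over a finite set of pairs: `QuantBHK.condCov_ge_avg_glauberTerm`, the `1/|E|` form).
For `X = ∅` this is the law of total covariance plus Harris; in general the conditional expectation `K_e G = E_ν[G | ω off e]` is NOT an
increasing function of the configuration, and the proof is new:  `Cov_ν(K_e F, K_e G) = (1−w_e)·X₁ + w_e·X₂` with `X₁ = Cov_ν(F(C_s), G(C_s(ω∖e)))`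
(= BHK 1.3, the e-deleted cluster being an increasing function of the cluster) and `X₂ = Cov_ν(F(C_s), G(C_s(ω⁺)))`, `ω⁺` = ω with e opened
iff that keeps `s ↮ X` — and `X₂ ≥ 0` («forced-opening correlation», `QuantBHK.forcedOpening_sum`) is the `X = Y` case of
`QuantBHK.coreHat`: BHK's Theorem-1.1 induction on the vertex set (tree `BHK2006.core`, word for word) with the forced-opened cluster
`rCHat` in the G-slot — base case with one extra pointwise domination, the block identity `rCHat_restrict`, and antitonicity of the hatted
block in the avoided set.  The one-pair resampling identity `sum_resample` does the final bookkeeping.  (Mined as row M2-R8 from exact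
censuses — 0 violations in ≈ 4·10⁶ instances — before the proof was found; lane PROOFS §P11–P12.)  Printed kin of the hatted
inequality (TP) (`QuantBHK.coreHat`, previous file): BHK's Thm 1.1 and van den Berg–Kahn's Thm 1.2, with the same placement (joint term at
`X ∩ Y`, bare avoidance at `X ∪ Y`); van den Berg–Kahn's Remark 2 is the printed negative for moving mass into the `X ∪ Y` factor, matching
the failure of every other hat placement in the lane's censuses; neither source has a forced-opened cluster.
[cite: VandenbergHaggstromKahn2005, Thm. 1.1 (pp. 3–5), Thm. 1.3 (p. 6), display (4) (p. 4), identity (6) (p. 4)]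
[cite: VandenbergKahn2001, Thm. 1.2 (p. 123), Remark 2 (p. 124)]
-/

noncomputable section

open MeasureTheory
open Literature.Probability.LatticeModels (prodBernoulli)

namespace Summit.CriticalPhenomena.PercolationContinuityZ3.Theorems

namespace QuantBHK

open Literature.Probability.Percolation Literature.Probability.Percolation.BHK2006
open scoped Classical
open DecisionTree (ind ind_of_mem ind_of_not_mem ind_nonneg)

section Assembly

variable {V : Type*} [Fintype V]

/-- `P(e ∈ ω) = w e` in the sum formalism. [cite: VandenbergHaggstromKahn2005, Thm. 1.1 (pp. 3–5), Thm. 1.3 (p. 6)] -/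
theorem sum_weight_ind_mem (w : Sym2 V → unitInterval) (e : Sym2 V) :
    ∑ ω, weight (fun f => (w f : ℝ)) ω * ind {ω : Set (Sym2 V) | e ∈ ω} ω = w e := by
  have h1 : ∫ ω, Set.indicator {ω : Set (Sym2 V) | e ∈ ω} (fun _ => (1 : ℝ)) ω ∂(prodBernoulli w) =
      ∑ ω, weight (fun f => (w f : ℝ)) ω * ind {ω : Set (Sym2 V) | e ∈ ω} ω := by
    rw [integral_prodBernoulli_eq_sum]
    refine Finset.sum_congr rfl fun ω _ => ?_
    by_cases hω : ω ∈ {ω : Set (Sym2 V) | e ∈ ω}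
    · rw [Set.indicator_of_mem hω, ind_of_mem hω, mul_one]
    · rw [Set.indicator_of_notMem hω, ind_of_not_mem hω, mul_zero]
  rw [← h1, integral_indicator MeasurableSet.of_discrete, integral_const, smul_eq_mul, mul_one,
    measureReal_restrict_apply_univ]
  exact Literature.Probability.LatticeModels.prodBernoulli_real_setOf_mem w e

/-- **Resampling one pair**: `E[h] = E[ w_e·h(ω ∪ {e}) + (1 − w_e)·h(ω ∖ {e}) ]`. [cite: VandenbergHaggstromKahn2005, Thm. 1.1 (pp. 3–5), Thm. 1.3 (p. 6)] -/
theorem sum_resample (w : Sym2 V → unitInterval) (e : Sym2 V) (h : Set (Sym2 V) → ℝ) :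
    ∑ ω, weight (fun f => (w f : ℝ)) ω * h ω =
      ∑ ω, weight (fun f => (w f : ℝ)) ω * ((w e : ℝ) * h (insert e ω) + (1 - (w e : ℝ)) * h (ω \ {e})) := by
  set w' : Sym2 V → ℝ := fun f => (w f : ℝ) with hw'
  have hm : ∑ ω, weight w' ω = 1 := by
    have h1 := integral_prodBernoulli_eq_sum w fun _ => (1 : ℝ)
    simp only [integral_const, probReal_univ, smul_eq_mul, mul_one] at h1
    exact h1.symm
  have hfub := blockFubini w' ({e} : Set (Sym2 V)) (fun ζ η => h (ζ ∪ η))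
  rw [hm, one_mul] at hfub
  have hL : ∀ ω : Set (Sym2 V), h ((ω ∩ {e}) ∪ (ω \ {e})) = h ω := fun ω => by rw [Set.inter_union_sdiff]
  simp only [hL] at hfub
  rw [hfub]
  have hpe : ∑ ω, weight w' ω * ind {ω : Set (Sym2 V) | e ∈ ω} ω = w e := sum_weight_ind_mem w e
  have hqe : ∑ ω, weight w' ω * ind {ω : Set (Sym2 V) | e ∉ ω} ω = 1 - (w e : ℝ) := by
    have : ∀ ω : Set (Sym2 V), ind {ω : Set (Sym2 V) | e ∉ ω} ω = 1 - ind {ω : Set (Sym2 V) | e ∈ ω} ω := fun ω => by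
      by_cases he : e ∈ ω
      · rw [ind_of_mem (show ω ∈ {ω : Set (Sym2 V) | e ∈ ω} from he),
          ind_of_not_mem (show ω ∉ {ω : Set (Sym2 V) | e ∉ ω} from fun h => h he)]; ring
      · rw [ind_of_not_mem (show ω ∉ {ω : Set (Sym2 V) | e ∈ ω} from he),
          ind_of_mem (show ω ∈ {ω : Set (Sym2 V) | e ∉ ω} from he)]; ring
    simp_rw [this, mul_sub, mul_one, Finset.sum_sub_distrib, hm, hpe]
  have hinner : ∀ ω' : Set (Sym2 V), ∑ ω, weight w' ω * h ((ω ∩ {e}) ∪ (ω' \ {e})) =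
      (w e : ℝ) * h (insert e ω') + (1 - (w e : ℝ)) * h (ω' \ {e}) := by
    intro ω'
    have hpt : ∀ ω : Set (Sym2 V), weight w' ω * h ((ω ∩ {e}) ∪ (ω' \ {e})) =
        (weight w' ω * ind {ω : Set (Sym2 V) | e ∈ ω} ω) * h (insert e ω') +
          (weight w' ω * ind {ω : Set (Sym2 V) | e ∉ ω} ω) * h (ω' \ {e}) := by
      intro ω
      by_cases he : e ∈ ω
      · have h1 : ω ∩ {e} = {e} := by
          ext f; simp only [Set.mem_inter_iff, Set.mem_singleton_iff]
          exact ⟨fun h => h.2, fun h => ⟨h ▸ he, h⟩⟩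
        rw [h1, Set.singleton_union, Set.insert_sdiff_singleton, ind_of_mem (show ω ∈ {ω : Set (Sym2 V) | e ∈ ω} from he),
          ind_of_not_mem (show ω ∉ {ω : Set (Sym2 V) | e ∉ ω} from fun h => h he)]
        ring
      · have h1 : ω ∩ {e} = ∅ := by
          ext f; simp only [Set.mem_inter_iff, Set.mem_singleton_iff, Set.mem_empty_iff_false, iff_false, not_and]
          exact fun hf hfe => he (hfe ▸ hf)
        rw [h1, Set.empty_union, ind_of_not_mem (show ω ∉ {ω : Set (Sym2 V) | e ∈ ω} from he),
          ind_of_mem (show ω ∈ {ω : Set (Sym2 V) | e ∉ ω} from he)]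
        ring
    simp_rw [hpt, Finset.sum_add_distrib, ← Finset.sum_mul, hpe, hqe]
  simp_rw [Finset.mul_sum]
  rw [Finset.sum_comm]
  refine Finset.sum_congr rfl fun ω' _ => ?_
  rw [← hinner ω', Finset.mul_sum]
  exact Finset.sum_congr rfl fun ω _ => by ring

omit [Fintype V] in
/-- The cluster with `e` closed is an increasing function of the cluster: `C_s(ω ∖ e) = C_s(C_s(ω) ∖ e)`. [cite: VandenbergHaggstromKahn2005, Thm. 1.1 (pp. 3–5), Thm. 1.3 (p. 6)] -/
theorem openEdgeCluster_diff_singleton (ω : Set (Sym2 V)) (s : V) (e : Sym2 V) :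
    openEdgeCluster (ω \ {e}) s = openEdgeCluster (openEdgeCluster ω s \ {e}) s := by
  refine Set.Subset.antisymm ?_ (openEdgeCluster_mono (Set.sdiff_subset_sdiff_left (openEdgeCluster_subset ω s)) s)
  intro f hf
  simp only [mem_openEdgeCluster_iff, Set.mem_sdiff] at hf ⊢
  obtain ⟨⟨hfω, hfe⟩, hd, hr⟩ := hf
  have key : ∀ v, (openGraph (ω \ {e})).Reachable s v → (openGraph (openEdgeCluster ω s \ {e})).Reachable s v := by
    intro v hv
    obtain ⟨q⟩ := hv
    refine ⟨q.transfer (openGraph (openEdgeCluster ω s \ {e})) fun g hg => ?_⟩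
    have hg' := q.edges_subset_edgeSet hg
    rw [openGraph, SimpleGraph.edgeSet_fromEdgeSet] at hg' ⊢
    refine ⟨⟨⟨hg'.1.1, hg'.2, fun v hv => ?_⟩, hg'.1.2⟩, hg'.2⟩
    exact ((q.takeUntil v (SimpleGraph.Walk.mem_support_of_mem_edges hg hv)).reachable).mono
      (openGraph_le Set.sdiff_subset)
  exact ⟨⟨⟨hfω, hd, fun v hv => (hr v hv).mono (openGraph_le Set.sdiff_subset)⟩, hfe⟩, hd, fun v hv => key v (hr v hv)⟩

/-- **Quantitative BHK Thm 1.3 (Glauber floor), sum form.**  `D = R_X = {s ↮ X}`, `F, G ≥ 0` increasing on edge sets, `e` any pair,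
`b = w e`, `a = 1 − b`, `ΔF(ω) = F(C_s(ω∪e)) − F(C_s(ω∖e))`:
  `μ(D)·(a·b·Σ_ω w(ω)·1_D(ω∪e)·ΔF·ΔG) ≤ μ(D)·Σ w·F G 1_D − (Σ w·F 1_D)(Σ w·G 1_D)`,
i.e. `Cov_ν(F,G) ≥ E_ν[Cov_ν(F,G | ω off e)]` for `ν = μ(·|s↮X)`: row M2-R8(a) of the prim-rate lane.
Proof: `Cov_ν(K_eF,K_eG) = a·[BHK 1.3 for (F, G∘π)] + b·(FO)` (PROOFS §P12). [cite: VandenbergHaggstromKahn2005, Thm. 1.1 (pp. 3–5), Thm. 1.3 (p. 6)] -/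
theorem glauberFloor_sum (w : Sym2 V → unitInterval) (e : Sym2 V) (s : V) (X : Set V)
    (F G : Set (Sym2 V) → ℝ) (hF : Monotone F) (hG : Monotone G) (hF0 : ∀ a, 0 ≤ F a) (hG0 : ∀ a, 0 ≤ G a) :
    (∑ ω, weight (fun f => (w f : ℝ)) ω * ind (rD Finset.univ s X) ω) *
        ((1 - (w e : ℝ)) * (w e : ℝ) * ∑ ω, weight (fun f => (w f : ℝ)) ω *
          (ind (rD Finset.univ s X) (insert e ω) *
            ((F (openEdgeCluster (insert e ω) s) - F (openEdgeCluster (ω \ {e}) s)) *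
              (G (openEdgeCluster (insert e ω) s) - G (openEdgeCluster (ω \ {e}) s))))) ≤
      (∑ ω, weight (fun f => (w f : ℝ)) ω * ind (rD Finset.univ s X) ω) *
          (∑ ω, weight (fun f => (w f : ℝ)) ω * (F (openEdgeCluster ω s) * G (openEdgeCluster ω s) * ind (rD Finset.univ s X) ω)) -
        (∑ ω, weight (fun f => (w f : ℝ)) ω * (F (openEdgeCluster ω s) * ind (rD Finset.univ s X) ω)) *
          (∑ ω, weight (fun f => (w f : ℝ)) ω * (G (openEdgeCluster ω s) * ind (rD Finset.univ s X) ω)) := by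
  set w' : Sym2 V → ℝ := fun f => (w f : ℝ) with hw'
  have hw0 : ∀ f, 0 ≤ w' f := fun f => (w f).2.1
  have hw1 : ∀ f, w' f ≤ 1 := fun f => (w f).2.2
  have hm : ∑ ω, weight w' ω = 1 := by
    have h1 := integral_prodBernoulli_eq_sum w fun _ => (1 : ℝ)
    simp only [integral_const, probReal_univ, smul_eq_mul, mul_one] at h1
    exact h1.symm
  set D := rD (Finset.univ : Finset V) s X with hD
  set b : ℝ := (w e : ℝ) with hb
  have hb0 : 0 ≤ b := (w e).2.1
  have hb1 : b ≤ 1 := (w e).2.2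
  -- (FO) and BHK 1.3 for `(F, G ∘ π)`
  have hFO := forcedOpening_sum w' hw0 hw1 hm e s X F G hF hG hF0 hG0
  simp only [CovTau.rC_univ] at hFO
  have hπmono : Monotone fun W : Set (Sym2 V) => G (openEdgeCluster (W \ {e}) s) := fun W W' h =>
    hG (openEdgeCluster_mono (Set.sdiff_subset_sdiff_left h) s)
  have hX1 := core w' hw0 hw1 hm Finset.univ s (Finset.mem_univ s) X X (by simp) (by simp) F
    (fun W => G (openEdgeCluster (W \ {e}) s)) hF hπmono hF0 (fun _ => hG0 _)
  rw [Set.inter_self, Set.union_self] at hX1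
  simp only [CovTau.rC_univ, ← openEdgeCluster_diff_singleton] at hX1
  -- pointwise facts about the three clusters
  have hins : ∀ ω : Set (Sym2 V), insert e (ω \ {e}) = insert e ω := fun ω => Set.insert_sdiff_singleton
  have hdel : ∀ ω : Set (Sym2 V), insert e ω \ {e} = ω \ {e} := fun ω => by
    ext f; simp only [Set.mem_sdiff, Set.mem_insert_iff, Set.mem_singleton_iff]; tauto
  have hhat_ins : ∀ ω : Set (Sym2 V), rCHat Finset.univ s X e (insert e ω) = openEdgeCluster (insert e ω) s := fun ω => by
    unfold rCHat; rw [Set.insert_eq_of_mem (Set.mem_insert e ω)]; simp only [CovTau.rC_univ, ite_self]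
  have hhat_del : ∀ ω : Set (Sym2 V), rCHat Finset.univ s X e (ω \ {e}) =
      if insert e ω ∈ D then openEdgeCluster (insert e ω) s else openEdgeCluster (ω \ {e}) s := fun ω => by
    unfold rCHat; rw [hins]; simp only [CovTau.rC_univ, hD]
  have hdec : ∀ ω : Set (Sym2 V), insert e ω ∈ D → ω \ {e} ∈ D := fun ω h =>
    rD_decreasing (Set.sdiff_subset.trans (Set.subset_insert e ω)) h
  -- the resampling identities (I1) and (I2)
  have hdel2 : ∀ ω : Set (Sym2 V), (ω \ {e}) \ {e} = ω \ {e} := fun ω => by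
    ext f; simp only [Set.mem_sdiff, Set.mem_singleton_iff]; tauto
  have I1 : ∑ ω, weight w' ω * (G (openEdgeCluster ω s) * ind D ω) =
      (1 - b) * ∑ ω, weight w' ω * (G (openEdgeCluster (ω \ {e}) s) * ind D ω) +
        b * ∑ ω, weight w' ω * (G (rCHat Finset.univ s X e ω) * ind D ω) := by
    rw [sum_resample w e (fun ω => G (openEdgeCluster ω s) * ind D ω),
      sum_resample w e (fun ω => G (openEdgeCluster (ω \ {e}) s) * ind D ω),
      sum_resample w e (fun ω => G (rCHat Finset.univ s X e ω) * ind D ω), Finset.mul_sum, Finset.mul_sum,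
      ← Finset.sum_add_distrib]
    refine Finset.sum_congr rfl fun ω _ => ?_
    simp only [hdel, hdel2, hhat_ins, hhat_del]
    by_cases h1 : insert e ω ∈ D
    · rw [if_pos h1, ind_of_mem h1, ind_of_mem (hdec ω h1)]
      ring
    · rw [if_neg h1, ind_of_not_mem h1]
      ring
  have I2 : ∑ ω, weight w' ω * (F (openEdgeCluster ω s) * G (openEdgeCluster ω s) * ind D ω) -
      (1 - b) * b * ∑ ω, weight w' ω * (ind D (insert e ω) *
        ((F (openEdgeCluster (insert e ω) s) - F (openEdgeCluster (ω \ {e}) s)) *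
          (G (openEdgeCluster (insert e ω) s) - G (openEdgeCluster (ω \ {e}) s)))) =
      (1 - b) * ∑ ω, weight w' ω * (F (openEdgeCluster ω s) * G (openEdgeCluster (ω \ {e}) s) * ind D ω) +
        b * ∑ ω, weight w' ω * (F (openEdgeCluster ω s) * G (rCHat Finset.univ s X e ω) * ind D ω) := by
    rw [sum_resample w e (fun ω => F (openEdgeCluster ω s) * G (openEdgeCluster ω s) * ind D ω),
      sum_resample w e (fun ω => F (openEdgeCluster ω s) * G (openEdgeCluster (ω \ {e}) s) * ind D ω),
      sum_resample w e (fun ω => F (openEdgeCluster ω s) * G (rCHat Finset.univ s X e ω) * ind D ω),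
      Finset.mul_sum, Finset.mul_sum, Finset.mul_sum, ← Finset.sum_sub_distrib, ← Finset.sum_add_distrib]
    refine Finset.sum_congr rfl fun ω _ => ?_
    simp only [hdel, hdel2, hhat_ins, hhat_del]
    by_cases h1 : insert e ω ∈ D
    · rw [if_pos h1, ind_of_mem h1, ind_of_mem (hdec ω h1)]
      ring
    · rw [if_neg h1, ind_of_not_mem h1]
      ring
  -- assemble: `a·[BHK] + b·(FO)`
  rw [← hD] at hX1 hFO
  have hA := mul_le_mul_of_nonneg_left hX1 (sub_nonneg.2 hb1)
  have hB := mul_le_mul_of_nonneg_left hFO hb0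
  set SF := ∑ ω, weight w' ω * (F (openEdgeCluster ω s) * ind D ω) with hSF
  set SG := ∑ ω, weight w' ω * (G (openEdgeCluster ω s) * ind D ω) with hSG
  set SG0 := ∑ ω, weight w' ω * (G (openEdgeCluster (ω \ {e}) s) * ind D ω) with hSG0
  set SGh := ∑ ω, weight w' ω * (G (rCHat Finset.univ s X e ω) * ind D ω) with hSGh
  set SFG := ∑ ω, weight w' ω * (F (openEdgeCluster ω s) * G (openEdgeCluster ω s) * ind D ω) with hSFG
  set SFG0 := ∑ ω, weight w' ω * (F (openEdgeCluster ω s) * G (openEdgeCluster (ω \ {e}) s) * ind D ω) with hSFG0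
  set SFGh := ∑ ω, weight w' ω * (F (openEdgeCluster ω s) * G (rCHat Finset.univ s X e ω) * ind D ω) with hSFGh
  set SD := ∑ ω, weight w' ω * (ind D (insert e ω) *
    ((F (openEdgeCluster (insert e ω) s) - F (openEdgeCluster (ω \ {e}) s)) *
      (G (openEdgeCluster (insert e ω) s) - G (openEdgeCluster (ω \ {e}) s)))) with hSD
  set μD := ∑ ω, weight w' ω * ind D ω with hμD
  have I2' : SFG = (1 - b) * SFG0 + b * SFGh + (1 - b) * b * SD := by linarith [I2]
  rw [I2', I1]
  nlinarith [hA, hB]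


end Assembly

section Typed

open MeasureTheory Set Literature.Probability.LatticeModels

variable {V : Type*} [Fintype V]

/-- **Quantitative BHK Thm 1.3 — the Glauber floor (row M2-R8(a)), integral form with vertex clusters.**  For `D = {s ↮ X}`,
`F, G : Set V → ℝ` increasing and any pair `e`:
`μ(D) · w_e(1−w_e) ∫ 1_D(ω∪e)·(F(C_s(ω∪e)) − F(C_s(ω∖e)))·(G(C_s(ω∪e)) − G(C_s(ω∖e))) dμ ≤ μ(D)·∫_D F(C_s)G(C_s) − (∫_D F(C_s))(∫_D G(C_s))`,
i.e. `Cov_ν(F,G) ≥ E_ν[Cov_ν(F,G | ω off e)]` for `ν = μ(·|s↮X)`.  From `glauberFloor_sum` (shift `F − F ∅`, `G − G ∅`; vertex span lift). [cite: VandenbergHaggstromKahn2005, Thm. 1.1 (pp. 3–5), Thm. 1.3 (p. 6)] -/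
theorem condCov_ge_glauberTerm (w : Sym2 V → unitInterval) (s : V) (X : Set V) (e : Sym2 V) (F G : Set V → ℝ)
    (hF : Monotone F) (hG : Monotone G) :
    (prodBernoulli w).real {ω : BondConfig V | ∀ x ∈ X, ¬ (openGraph ω).Reachable s x} *
        ((w e : ℝ) * (1 - w e) *
          ∫ ω, ({ω : BondConfig V | ∀ x ∈ X, ¬ (openGraph ω).Reachable s x}).indicator (fun _ => (1 : ℝ)) (insert e ω) *
            ((F (openCluster (insert e ω) s) - F (openCluster (ω \ {e}) s)) *
              (G (openCluster (insert e ω) s) - G (openCluster (ω \ {e}) s))) ∂(prodBernoulli w)) ≤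
      (prodBernoulli w).real {ω : BondConfig V | ∀ x ∈ X, ¬ (openGraph ω).Reachable s x} *
          (∫ ω in {ω : BondConfig V | ∀ x ∈ X, ¬ (openGraph ω).Reachable s x},
            F (openCluster ω s) * G (openCluster ω s) ∂(prodBernoulli w)) -
        (∫ ω in {ω : BondConfig V | ∀ x ∈ X, ¬ (openGraph ω).Reachable s x}, F (openCluster ω s) ∂(prodBernoulli w)) *
          (∫ ω in {ω : BondConfig V | ∀ x ∈ X, ¬ (openGraph ω).Reachable s x}, G (openCluster ω s) ∂(prodBernoulli w)) := by
  classical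
  set μ := prodBernoulli w with hμ
  set D : Set (BondConfig V) := {ω : BondConfig V | ∀ x ∈ X, ¬ (openGraph ω).Reachable s x} with hD
  have hDm : MeasurableSet D := MeasurableSet.of_discrete
  set w' : Sym2 V → ℝ := fun f => (w f : ℝ) with hw'
  -- the vertex-span lift of `F − F ∅`, `G − G ∅`
  set vs : Set (Sym2 V) → Set V := fun C => {a : V | a = s ∨ ∃ e' ∈ C, a ∈ e'} with hvs
  have hvsC : ∀ ζ : BondConfig V, vs (openEdgeCluster ζ s) = openCluster ζ s := fun ζ => by
    rw [KNPreFKG.openCluster_eq_setOf_openEdgeCluster]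
  have hvmono : Monotone vs := by
    intro C C' h a ha
    rcases ha with h1 | ⟨e', he', hae'⟩
    · exact Or.inl h1
    · exact Or.inr ⟨e', h he', hae'⟩
  set Fe : Set (Sym2 V) → ℝ := fun C => F (vs C) - F (vs ∅) with hFe
  set Ge : Set (Sym2 V) → ℝ := fun C => G (vs C) - G (vs ∅) with hGe
  have hFem : Monotone Fe := fun C C' h => sub_le_sub_right (hF (hvmono h)) _
  have hGem : Monotone Ge := fun C C' h => sub_le_sub_right (hG (hvmono h)) _
  have hFe0 : ∀ C, 0 ≤ Fe C := fun C => sub_nonneg.2 (hF (hvmono (Set.empty_subset C)))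
  have hGe0 : ∀ C, 0 ≤ Ge C := fun C => sub_nonneg.2 (hG (hvmono (Set.empty_subset C)))
  have key := glauberFloor_sum w e s X Fe Ge hFem hGem hFe0 hGe0
  rw [CovTau.rD_univ] at key
  -- convert the sums to integrals
  have hint : ∀ h : BondConfig V → ℝ, ∫ ω in D, h ω ∂μ = ∑ ω, BHK2006.weight w' ω * (h ω * DecisionTree.ind D ω) := by
    intro h
    rw [← integral_indicator hDm, BHK2006.integral_prodBernoulli_eq_sum]
    refine Finset.sum_congr rfl fun ω _ => ?_
    by_cases hω : ω ∈ D
    · rw [Set.indicator_of_mem hω, DecisionTree.ind_of_mem hω, mul_one]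
    · rw [Set.indicator_of_notMem hω, DecisionTree.ind_of_not_mem hω]; ring
  have hreal : μ.real D = ∑ ω, BHK2006.weight w' ω * DecisionTree.ind D ω := by
    rw [← integral_indicator_one hDm, BHK2006.integral_prodBernoulli_eq_sum]
    refine Finset.sum_congr rfl fun ω _ => ?_
    by_cases hω : ω ∈ D
    · rw [Set.indicator_of_mem hω, DecisionTree.ind_of_mem hω, Pi.one_apply]
    · rw [Set.indicator_of_notMem hω, DecisionTree.ind_of_not_mem hω, mul_zero]
  have hglaub : ∫ ω, D.indicator (fun _ => (1 : ℝ)) (insert e ω) *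
      ((F (openCluster (insert e ω) s) - F (openCluster (ω \ {e}) s)) *
        (G (openCluster (insert e ω) s) - G (openCluster (ω \ {e}) s))) ∂μ =
      ∑ ω, BHK2006.weight w' ω * (DecisionTree.ind D (insert e ω) *
        ((Fe (openEdgeCluster (insert e ω) s) - Fe (openEdgeCluster (ω \ {e}) s)) *
          (Ge (openEdgeCluster (insert e ω) s) - Ge (openEdgeCluster (ω \ {e}) s)))) := by
    rw [BHK2006.integral_prodBernoulli_eq_sum]
    refine Finset.sum_congr rfl fun ω _ => ?_
    simp only [hFe, hGe, hvsC]
    by_cases hω : insert e ω ∈ D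
    · rw [Set.indicator_of_mem hω, DecisionTree.ind_of_mem hω]; ring
    · rw [Set.indicator_of_notMem hω, DecisionTree.ind_of_not_mem hω]; ring
  -- the shifted integrals
  have e1 : ∑ ω, BHK2006.weight w' ω * (Fe (openEdgeCluster ω s) * DecisionTree.ind D ω) =
      ∫ ω in D, F (openCluster ω s) ∂μ - F (vs ∅) * μ.real D := by
    rw [hint, hreal, Finset.mul_sum, ← Finset.sum_sub_distrib]
    refine Finset.sum_congr rfl fun ω _ => ?_
    simp only [hFe, hvsC]; ring
  have e2 : ∑ ω, BHK2006.weight w' ω * (Ge (openEdgeCluster ω s) * DecisionTree.ind D ω) =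
      ∫ ω in D, G (openCluster ω s) ∂μ - G (vs ∅) * μ.real D := by
    rw [hint, hreal, Finset.mul_sum, ← Finset.sum_sub_distrib]
    refine Finset.sum_congr rfl fun ω _ => ?_
    simp only [hGe, hvsC]; ring
  have e3 : ∑ ω, BHK2006.weight w' ω * (Fe (openEdgeCluster ω s) * Ge (openEdgeCluster ω s) * DecisionTree.ind D ω) =
      ∫ ω in D, F (openCluster ω s) * G (openCluster ω s) ∂μ - G (vs ∅) * ∫ ω in D, F (openCluster ω s) ∂μ
        - F (vs ∅) * ∫ ω in D, G (openCluster ω s) ∂μ + F (vs ∅) * G (vs ∅) * μ.real D := by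
    rw [hint, hint, hint, hreal, Finset.mul_sum, Finset.mul_sum, Finset.mul_sum, ← Finset.sum_sub_distrib,
      ← Finset.sum_sub_distrib, ← Finset.sum_add_distrib]
    refine Finset.sum_congr rfl fun ω _ => ?_
    simp only [hFe, hGe, hvsC]; ring
  rw [e1, e2, e3, ← hreal, ← hglaub] at key
  have hb : (1 - (w e : ℝ)) * (w e : ℝ) = (w e : ℝ) * (1 - w e) := by ring
  rw [hb] at key
  nlinarith [key]

/-- **Row M2-R8(b): the `1/|E|` form** — for any finite set `E` of pairs,
`μ(D)·|E|⁻¹·Σ_{e∈E} w_e(1−w_e)∫1_D(ω∪e)ΔFΔG ≤ μ(D)∫_D FG − (∫_D F)(∫_D G)` (average of `condCov_ge_glauberTerm` over `e ∈ E`;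
for `E = ∅` it is BHK Thm 1.3). [cite: VandenbergHaggstromKahn2005, Thm. 1.1 (pp. 3–5), Thm. 1.3 (p. 6)] -/
theorem condCov_ge_avg_glauberTerm (w : Sym2 V → unitInterval) (s : V) (X : Set V) (E : Finset (Sym2 V)) (F G : Set V → ℝ)
    (hF : Monotone F) (hG : Monotone G) :
    (prodBernoulli w).real {ω : BondConfig V | ∀ x ∈ X, ¬ (openGraph ω).Reachable s x} *
        ((1 / (E.card : ℝ)) * ∑ e ∈ E, ((w e : ℝ) * (1 - w e) *
          ∫ ω, ({ω : BondConfig V | ∀ x ∈ X, ¬ (openGraph ω).Reachable s x}).indicator (fun _ => (1 : ℝ)) (insert e ω) *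
            ((F (openCluster (insert e ω) s) - F (openCluster (ω \ {e}) s)) *
              (G (openCluster (insert e ω) s) - G (openCluster (ω \ {e}) s))) ∂(prodBernoulli w))) ≤
      (prodBernoulli w).real {ω : BondConfig V | ∀ x ∈ X, ¬ (openGraph ω).Reachable s x} *
          (∫ ω in {ω : BondConfig V | ∀ x ∈ X, ¬ (openGraph ω).Reachable s x},
            F (openCluster ω s) * G (openCluster ω s) ∂(prodBernoulli w)) -
        (∫ ω in {ω : BondConfig V | ∀ x ∈ X, ¬ (openGraph ω).Reachable s x}, F (openCluster ω s) ∂(prodBernoulli w)) *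
          (∫ ω in {ω : BondConfig V | ∀ x ∈ X, ¬ (openGraph ω).Reachable s x}, G (openCluster ω s) ∂(prodBernoulli w)) := by
  classical
  set μ := prodBernoulli w with hμ
  set D : Set (BondConfig V) := {ω : BondConfig V | ∀ x ∈ X, ¬ (openGraph ω).Reachable s x} with hD
  set Cv : ℝ := μ.real D * (∫ ω in D, F (openCluster ω s) * G (openCluster ω s) ∂μ) -
    (∫ ω in D, F (openCluster ω s) ∂μ) * (∫ ω in D, G (openCluster ω s) ∂μ) with hCv
  set T : Sym2 V → ℝ := fun e => (w e : ℝ) * (1 - w e) *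
    ∫ ω, D.indicator (fun _ => (1 : ℝ)) (insert e ω) *
      ((F (openCluster (insert e ω) s) - F (openCluster (ω \ {e}) s)) *
        (G (openCluster (insert e ω) s) - G (openCluster (ω \ {e}) s))) ∂μ with hT
  have hTe : ∀ e, μ.real D * T e ≤ Cv := fun e => condCov_ge_glauberTerm w s X e F G hF hG
  -- `Cv ≥ 0` is BHK Thm 1.3 (vertex form), via the majorant shell with the trivial majorant... here: from `hTe` at any pair with
  -- a nonnegative Glauber term we cannot conclude; use the case split on `E`.
  rcases E.eq_empty_or_nonempty with hE | hE
  · subst hE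
    simp only [Finset.card_empty, Nat.cast_zero, div_zero, Finset.sum_empty, mul_zero]
    -- BHK Thm 1.3 for vertex clusters: `0 ≤ Cv`
    have vs_mono : Monotone fun C : Set (Sym2 V) => ({a : V | a = s ∨ ∃ e' ∈ C, a ∈ e'} : Set V) := by
      intro C C' h a ha
      rcases ha with h1 | ⟨e', he', hae'⟩
      · exact Or.inl h1
      · exact Or.inr ⟨e', h he', hae'⟩
    have hvsC : ∀ ζ : BondConfig V, ({a : V | a = s ∨ ∃ e' ∈ openEdgeCluster ζ s, a ∈ e'} : Set V) = openCluster ζ s :=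
      fun ζ => by rw [KNPreFKG.openCluster_eq_setOf_openEdgeCluster]
    by_cases hs : s ∈ X
    · have hDe : D = ∅ := Set.eq_empty_of_forall_notMem fun ω hω => hω s hs (SimpleGraph.Reachable.refl s)
      simp only [hCv, hDe, Measure.restrict_empty, integral_zero_measure, measureReal_empty, sub_zero,
        mul_zero, le_refl]
    have key := BHK2006_clusterConditionalPositiveAssociation_holds V w s X
      (fun C => F {a : V | a = s ∨ ∃ e' ∈ C, a ∈ e'}) (fun C => G {a : V | a = s ∨ ∃ e' ∈ C, a ∈ e'})
      (fun C C' h => hF (vs_mono h)) (fun C C' h => hG (vs_mono h)) hs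
    simp only [hvsC] at key
    simp only [hCv]
    linarith [key]
  · have hcard : (0 : ℝ) < E.card := by exact_mod_cast hE.card_pos
    have hsum : ∑ e ∈ E, μ.real D * T e ≤ ∑ e ∈ E, Cv := Finset.sum_le_sum fun e _ => hTe e
    rw [Finset.sum_const, nsmul_eq_mul, ← Finset.mul_sum] at hsum
    have : μ.real D * ((1 / (E.card : ℝ)) * ∑ e ∈ E, T e) = (μ.real D * ∑ e ∈ E, T e) / E.card := by
      field_simp
    rw [this, div_le_iff₀ hcard]
    nlinarith [hsum]

end Typed

end QuantBHK

end Summit.CriticalPhenomena.PercolationContinuityZ3.Theorems
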